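import Mathlib
import HarnessLib
import Literature.MathematicalPhysics.StatisticalMechanics.RenormalisationMapRemaindersThreeFourKernelSub

/-!
# The remainder sums `Σ₃`, `Σ₄` of `S_k` for TWO STEP KERNELS at a FIXED extracted Hamiltonian:
# the kernel-only pieces, linear in the pair constant `ℓ` ([ABKM19] Theorem 6.8 ⊗ Lemma 8.4; (12.53))

Companion of `RenormalisationMapRemainderTwoLargeKernelOnly` (`Σ₂ᴸ`).  The two-Hamiltonian twins of
`RenormalisationMapRemaindersThreeFourKernelSub` carry the factor `(1 + ℓ)` in front of a bracket with the non-small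
letters `8e^{1/4}‖H‖_{k,0}`, `C`, which does not vanish as the kernels merge.  For the volume-uniform `q`-Lipschitz
bound of `S_k` (child `TwoKernelSkBound` of the cruxes `HypACumulant` / `HypALocalTwoPoint` of the route
`Summits/HubbardSuperconductivity/…/Theses/ComplexGFFStiffness`, line `banach_two_kernel`) one splits
`ΔΣᵢ = [Σᵢ,a(H̃_a) − Σᵢ,a(H̃_b)] + [Σᵢ,a(H̃_b) − Σᵢ,b(H̃_b)]`; the first bracket is the landed ONE-kernel Lipschitz bound
(`H' = H`, `K' = K`), the second — the SAME extracted Hamiltonian on both sides, two kernels — is this file: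

* **`tayNormLE_remainderThree_kernelOnly_sub_abkm`** (disconnected preimages) and
  **`tayNormLE_remainderFour_kernelOnly_sub_abkm`** (pairs `∅ ≠ X₁ ⊊ X`):
  `|Σᵢ,a(H̃) − Σᵢ,b(H̃)| ≤ ℓ · κ^{|U|_k}(8e^{1/4}‖H‖ + C)(ωA⁴)·c₃^{|U|_{k+1}}A^{−η|U|_{k+1}}` — LINEAR in the pair
  constant `ℓ` of Lemma 8.4, per-block constant `max(A_{𝒫,a}, κ_p)` inside `c₃`, any `κ ≥ 1 + e^{1/4}`.

Proof: the two-Hamiltonian proofs verbatim with `H̃' := H̃` (the three `H̃`-variation summands vanish identically),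
the slot majorisation `kernelSlot_le_letterSlot` with its factor `ℓ` kept outside, the adapters
`reblockTerm_lipschitzConsts_le` (letters `Δ := 0`, `Δ_H := 8e^{1/4}‖H‖`, `C_Δ := C`) and the master counting lemma.
No smallness in `ℓ` is needed.  Everything is proved; no named fact.

## References
* S. Adams, S. Buchholz, R. Kotecký, S. Müller, arXiv:1910.13564, Theorem 6.8 ((6.59)–(6.60)), Lemma 9.6 (proof),
  Lemma 8.4, Lemma 12.6 (12.53) [AdamsBuchholzKoteckyMuller2019].
-/

noncomputable section

namespace Literature.MathematicalPhysics.StatisticalMechanics.GradientRG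

open scoped BigOperators Classical
open Finset Matrix MeasureTheory
open Literature.MathematicalPhysics.StatisticalMechanics.TorusPolymer
  (IsPolymer blocks polys bprod blockOf thicken reblock boxCorner mem_polys mem_blocks numBlocks isPolymer_blockOf
    card_blocks_eq_numBlocks blocks_blockOf empty_mem_polys closure reblockTerm_lipschitzConsts_le
    reblockTerm_lipschitzConsts_le_top sum_reblock_triples_le_pow sum_reblock_large_le_pow self_mem_polys
    bprod_empty two_le_degree_of_ne_self two_le_degree_self_of_not_isConn two_le_card_blocks_of_not_isConn
    reblock_empty two_le_degree_of_ssubset)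
open Literature.Barriers.CriticalPhenomena.LongRangePhi4.Polymer (IsConn components)
open Literature.MathematicalPhysics.StatisticalMechanics.GradientFRD (iterDiff)
open Literature.MathematicalPhysics.QuantumFieldTheory

variable {d M : ℕ} [NeZero M]

set_option maxHeartbeats 1600000 in
/-- **Kernel-only two-kernel piece of `Σ₃`, linear in `ℓ`** (disconnected preimages): same data conventions as
`tayNormLE_remainderTwoLarge_kernelOnly_sub_abkm` (one extracted Hamiltonian `H̃` on both sides); constant `ℓ`× the
one-kernel `Σ₃` constant in the letters `Δ := 0`, `Δ_H := 8e^{1/4}‖H‖_{k,0}`, `C_Δ := C`, `A_𝒫 := max(A_{𝒫,a}, κ_p)`.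
[cite: AdamsBuchholzKoteckyMuller2019, Theorem 6.8 / Lemma 9.6 (proof, first order) / Lemma 12.6 (12.53)] -/
theorem tayNormLE_remainderThree_kernelOnly_sub_abkm {L N Mord R n p r₀ : ℕ} {θbar lam μ δ₁ δ₀ A𝒫 A𝒫a A𝒫b C₂a C₂b h A : ℝ}
    {𝒞 : ℕ → (Fin d → ZMod M) → ℝ} (hd : 3 ≤ d) (hLodd : Odd L) (hL : 2 ^ (d + 3) + 16 * R ≤ L)
    (hR2 : 2 ≤ R) (hM : M = L ^ N) {k : ℕ} (hkN : k + 1 ≤ N)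
    {𝒞a 𝒞b : (Fin d → ZMod M) → ℝ}
    (hSa : StepKernelBounds (abkmWeightData L N Mord R θbar (schedDelta δ₀ δ₁ N) 𝒞) L k A𝒫a C₂a 𝒞a)
    (hSb : StepKernelBounds (abkmWeightData L N Mord R θbar (schedDelta δ₀ δ₁ N) 𝒞) L k A𝒫b C₂b 𝒞b)
    (hp : d / 2 + 1 ≤ p) (hMord : d / 2 + 1 ≤ Mord)
   
    (hB : AbkmWeightBounds L N Mord R n θbar lam μ δ₁ δ₀ A𝒫 𝒞
      (abkmWeightData L N Mord R θbar (schedDelta δ₀ δ₁ N) 𝒞))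
    (hδ₀ : 0 < δ₀) (hδ₁ : 0 < δ₁) (hh : 0 < h) (hh0 : hZeroSq d R δ₀ δ₁ ≤ h ^ 2) (hA𝒫 : 0 ≤ A𝒫a) (hA1 : 1 ≤ A)
    {U : Finset (Fin d → ZMod M)} (hU : IsPolymer (L ^ (k + 1)) U) (hUne : U.Nonempty)
    {Ht H : RelevantHamiltonian ℂ d} {τ : ℝ}
    (hHt : hamNorm (fieldWt h (L : ℝ) d k) ((L : ℝ) ^ k) (L ^ (d * k)) Ht ≤ τ)
    (hτ : τ ≤ 1 / 16)
    (hH : hamNorm (fieldWt h (L : ℝ) d k) ((L : ℝ) ^ k) (L ^ (d * k)) H ≤ 1 / 16)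
    {K : Finset (Fin d → ZMod M) → ((Fin d → ZMod M) → ℝ) → ℂ} {C : ℝ} (hC : 0 ≤ C)
    (hK : WeakNormLE (abkmNormParams L N Mord R p r₀ h θbar A (schedDelta δ₀ δ₁ N) 𝒞) k K C)
    (hKfac : Factorises (L ^ k) K) (hK0 : ∀ φ, K ∅ φ = 1) (hKd : ∀ Y, ContDiff ℝ r₀ (K Y))
    (hKloc : ∀ Y, IsPolymer (L ^ k) Y → IsConn Y →
      IsGaugeLocal ((abkmNormParams L N Mord R p r₀ h θbar A (schedDelta δ₀ δ₁ N) 𝒞).gauge k Y) (K Y))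
    {ℓ κp : ℝ} (hℓ : 0 ≤ ℓ) (hκp : 0 ≤ κp)
    (hdiff : ∀ X : Finset (Fin d → ZMod M), IsPolymer (L ^ k) X → X ⊆ thicken ((2 ^ d - 1) * L ^ k) U →
      ∀ (F : ((Fin d → ZMod M) → ℝ) → ℂ) (b : ℝ), 0 ≤ b → ContDiff ℝ r₀ F →
        IsGaugeLocal ((abkmNormParams L N Mord R p r₀ h θbar A (schedDelta δ₀ δ₁ N) 𝒞).gauge k X) F →
        TayNormLE ((abkmNormParams L N Mord R p r₀ h θbar A (schedDelta δ₀ δ₁ N) 𝒞).gauge k X) r₀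
          ((abkmWeightData L N Mord R θbar (schedDelta δ₀ δ₁ N) 𝒞).weight k X) F b →
          TayNormLE ((abkmNormParams L N Mord R p r₀ h θbar A (schedDelta δ₀ δ₁ N) 𝒞).gauge k X) r₀
            ((abkmWeightData L N Mord R θbar (schedDelta δ₀ δ₁ N) 𝒞).midWeight k X)
            (fluct 𝒞a F - fluct 𝒞b F) (b * ℓ * κp ^ numBlocks (L ^ k) X))
    {ω κ : ℝ}
    (hθω : 8 * Real.exp (1 / 4) * τ ≤ ω)
    (hbbω : 8 * Real.exp (1 / 4) * hamNorm (fieldWt h (L : ℝ) d k) ((L : ℝ) ^ k) (L ^ (d * k)) H +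
      8 * Real.exp (1 / 4) * hamNorm (fieldWt h (L : ℝ) d k) ((L : ℝ) ^ k) (L ^ (d * k)) H ≤ ω)
    (hCω : C + C ≤ ω) (hωA : ω * A ^ 2 ≤ 1)
    (hκ : 1 + Real.exp (1 / 4) ≤ κ) :
    TayNormLE ((abkmNormParams L N Mord R p r₀ h θbar A (schedDelta δ₀ δ₁ N) 𝒞).gauge (k + 1) U) r₀
      ((abkmWeightData L N Mord R θbar (schedDelta δ₀ δ₁ N) 𝒞).weight (k + 1) U)
      (fun φ => ∑ X ∈ ((polys (L ^ k) univ).filter (fun X => reblock (L ^ k) (L * L ^ k) X = U)).filter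
          (fun X => ¬ IsConn X),
        (bprod (L ^ k) (fun B => expNegH Ht B φ) (U \ X) * bprod (L ^ k) (fun B => expNegH (-Ht) B φ) (X \ U) *
            (fluct 𝒞a (polyP2 (L ^ k) H K X) φ + bprod (L ^ k) (fun B => 1 - expNegH Ht B φ) X) -
          bprod (L ^ k) (fun B => expNegH Ht B φ) (U \ X) * bprod (L ^ k) (fun B => expNegH (-Ht) B φ) (X \ U) *
            (fluct 𝒞b (polyP2 (L ^ k) H K X) φ + bprod (L ^ k) (fun B => 1 - expNegH Ht B φ) X)))
      (ℓ *
      (κ ^ (blocks (L ^ k) U).card *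
          ((8 * Real.exp (1 / 4) * hamNorm (fieldWt h (L : ℝ) d k) ((L : ℝ) ^ k) (L ^ (d * k)) H + C) *
            (ω * A ^ 4)) *
        (((2 * (2 * κ * max 1 (max A𝒫a κp))) ^ ((2 ^ (d + 1) + 2) ^ d * L ^ d) * (4 : ℝ) ^ ((2 ^ (d + 1) + 2) ^ d * L ^ d)) ^
            (blocks (L * L ^ k) U).card *
          A ^ (-((1 + 1 / ((2 * (2 ^ d + 1) + 6 : ℝ) ^ d)) * (blocks (L * L ^ k) U).card) : ℝ)))) := by
  have hA : 0 < A := by linarith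
  set A𝒫m : ℝ := max A𝒫a κp with hA𝒫m
  have hA𝒫m0 : 0 ≤ A𝒫m := le_max_of_le_left hA𝒫
  have hκpm : κp ≤ A𝒫m := le_max_right _ _
  have hSa' : StepKernelBounds (abkmWeightData L N Mord R θbar (schedDelta δ₀ δ₁ N) 𝒞) L k A𝒫m C₂a 𝒞a :=
    hSa.mono_A𝒫 hA𝒫 (le_max_left _ _)
  set P := abkmNormParams L N Mord R p r₀ h θbar A (schedDelta δ₀ δ₁ N) 𝒞 with hP
  set T := (polys (L ^ k) univ).filter (fun X => reblock (L ^ k) (L * L ^ k) X = U) with hT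
  set T₃ := T.filter (fun X => ¬ IsConn X) with hT₃
  have hT₃T : T₃ ⊆ T := filter_subset _ _
  have hT₃p : ∀ X ∈ T₃, IsPolymer (L ^ k) X := fun X hX => (mem_polys.1 (mem_filter.1 (hT₃T hX)).1).2
  have hT₃ne : ∀ X ∈ T₃, X.Nonempty := by
    intro X hX
    rw [nonempty_iff_ne_empty]
    rintro rfl
    have hU0 : U = ∅ := by rw [← (mem_filter.1 (hT₃T hX)).2, reblock_empty]
    exact hUne.ne_empty hU0
  have hT₃nc : ∀ X ∈ T₃, ¬ IsConn X := fun X hX => (mem_filter.1 hX).2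
  have h𝓨 : ∀ X ∈ T₃, ({∅, X} : Finset (Finset (Fin d → ZMod M))) ⊆ polys (L ^ k) X := by
    intro X hX X₁ hX₁
    rcases mem_insert.1 hX₁ with rfl | h1
    · exact empty_mem_polys _ _
    · rw [mem_singleton.1 h1]; exact self_mem_polys (hT₃p X hX)
  -- the explicit per-term Lipschitz bound, summed over `X₁ ∈ {∅, X}`
  have htool := tayNormLE_subsum_reblockTerm_kernel_sub_abkm (n := n) (lam := lam) (μ := μ) hd hLodd hL hR2 hM hkN
    hSa' hSb hp hMord hB hδ₀ hδ₁ hh hh0 hA𝒫m0 hA hU (𝓧' := T₃) hT₃T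
    (𝓨 := fun X => ({∅, X} : Finset (Finset (Fin d → ZMod M)))) h𝓨
    hHt hHt hτ hH hC hK hKfac hK0 hKd hKloc hℓ hκp hdiff
  -- the two reblocked terms of a disconnected preimage are the third remainder summand
  have hfun : (fun φ : (Fin d → ZMod M) → ℝ => ∑ X ∈ T₃, ∑ X₁ ∈ ({∅, X} : Finset (Finset (Fin d → ZMod M))),
      (bprod (L ^ k) (fun B => expNegH Ht B φ) (U \ X) * bprod (L ^ k) (fun B => expNegH (-Ht) B φ) (X \ U) *
          (bprod (L ^ k) (fun B => 1 - expNegH Ht B φ) X₁ * fluct 𝒞a (polyP2 (L ^ k) H K (X \ X₁)) φ) -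
        bprod (L ^ k) (fun B => expNegH Ht B φ) (U \ X) * bprod (L ^ k) (fun B => expNegH (-Ht) B φ) (X \ U) *
          (bprod (L ^ k) (fun B => 1 - expNegH Ht B φ) X₁ *
            fluct 𝒞b (polyP2 (L ^ k) H K (X \ X₁)) φ))) =
      fun φ => ∑ X ∈ T₃,
        (bprod (L ^ k) (fun B => expNegH Ht B φ) (U \ X) * bprod (L ^ k) (fun B => expNegH (-Ht) B φ) (X \ U) *
            (fluct 𝒞a (polyP2 (L ^ k) H K X) φ + bprod (L ^ k) (fun B => 1 - expNegH Ht B φ) X) -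
          bprod (L ^ k) (fun B => expNegH Ht B φ) (U \ X) * bprod (L ^ k) (fun B => expNegH (-Ht) B φ) (X \ U) *
            (fluct 𝒞b (polyP2 (L ^ k) H K X) φ + bprod (L ^ k) (fun B => 1 - expNegH Ht B φ) X)) := by
    funext φ
    refine sum_congr rfl fun X hX => ?_
    rw [sum_pair (hT₃ne X hX).ne_empty.symm]
    simp only [bprod_empty, sdiff_empty, Finset.sdiff_self, polyP2_empty _ _ hK0,
      fluct_const]
    ring
  rw [hfun] at htool
  refine htool.mono ?_ (fun _ => (Real.exp_pos _).le)
  -- sizes and parities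
  have h2dle : 2 ^ d ≤ 2 ^ (d + 3) := Nat.pow_le_pow_right (by norm_num) (by omega)
  have h1le : 1 ≤ 2 ^ d := Nat.one_le_two_pow
  have hL2 : 2 ^ d + 1 ≤ L := by omega
  have hL4 : 4 ≤ L := by omega
  have hMo : Odd M := by rw [hM]; exact hLodd.pow
  have hsodd : Odd (L ^ k) := hLodd.pow
  have hU' : IsPolymer (L * L ^ k) U := by
    rw [show L * L ^ k = L ^ (k + 1) by rw [pow_succ']]; exact hU
  -- nonnegativity of the letters
  have hnn : ∀ H₀ : RelevantHamiltonian ℂ d,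
      0 ≤ hamNorm (fieldWt h (L : ℝ) d k) ((L : ℝ) ^ k) (L ^ (d * k)) H₀ := fun H₀ =>
    hamNorm_nonneg (fieldWt_pos hh (by exact_mod_cast hLodd.pos) d k).le (by positivity) _ H₀
  have hτ0 : 0 ≤ τ := (hnn Ht).trans hHt
  have haF : ∀ Z, P.aFactor k Z = (A ^ (blocks (L ^ k) Z).card)⁻¹ := fun Z => by
    rw [hP, NormParams.aFactor, abkmNormParams_A, abkmNormParams_L, card_blocks_eq_numBlocks]
  -- the `H̃`-difference letter vanishes (`H̃' = H̃`); the adapters' letters in that form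
  have hΔ0 : hamNorm (fieldWt h (L : ℝ) d k) ((L : ℝ) ^ k) (L ^ (d * k)) (Ht - Ht) = 0 := by
    rw [sub_self, hamNorm_zero]
  have hθω' : 8 * Real.exp (1 / 4) * τ +
      16 * Real.exp (3 / 8) * hamNorm (fieldWt h (L : ℝ) d k) ((L : ℝ) ^ k) (L ^ (d * k)) (Ht - Ht) ≤ ω := by
    rw [hΔ0, mul_zero, add_zero]; exact hθω
  have hbω : 8 * Real.exp (1 / 4) * hamNorm (fieldWt h (L : ℝ) d k) ((L : ℝ) ^ k) (L ^ (d * k)) H ≤ ω :=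
    le_trans (le_add_of_nonneg_right (by have := hnn H; positivity)) hbbω
  have hκ' : 1 + Real.exp (1 / 4) +
      16 * Real.exp (3 / 8) * hamNorm (fieldWt h (L : ℝ) d k) ((L : ℝ) ^ k) (L ^ (d * k)) (Ht - Ht) ≤ κ := by
    rw [hΔ0, mul_zero, add_zero]; exact hκ
  have hprod0 : ∀ (S : Finset (Finset (Fin d → ZMod M))) (x : ℝ),
      (∏ _B ∈ S, (x + 16 * Real.exp (3 / 8) * hamNorm (fieldWt h (L : ℝ) d k) ((L : ℝ) ^ k) (L ^ (d * k)) (Ht - Ht))) -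
        ∏ _B ∈ S, x = 0 := fun S x => by
    rw [hΔ0, mul_zero, add_zero, sub_self]
  have hEeq : κ ^ (blocks (L ^ k) U).card *
      ((8 * Real.exp (1 / 4) * hamNorm (fieldWt h (L : ℝ) d k) ((L : ℝ) ^ k) (L ^ (d * k)) H + C) * (ω * A ^ 4)) =
      κ ^ (blocks (L ^ k) U).card *
      ((3 * (16 * Real.exp (3 / 8) * hamNorm (fieldWt h (L : ℝ) d k) ((L : ℝ) ^ k) (L ^ (d * k)) (Ht - Ht)) +
          8 * Real.exp (1 / 4) * hamNorm (fieldWt h (L : ℝ) d k) ((L : ℝ) ^ k) (L ^ (d * k)) H + C) *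
        (ω * A ^ 4)) := by
    rw [hΔ0]; ring
  -- Step 1: the degree of the terms of a disconnected preimage
  have hstep : ∀ X ∈ T₃, ∀ X₁ ∈ ({∅, X} : Finset (Finset (Fin d → ZMod M))),
      ∀ Y ∈ polys (L ^ k) (X \ X₁), 2 ≤ (blocks (L ^ k) (X \ Y)).card + (components Y).card := by
    intro X hX X₁ hX₁ Y hY
    have hXp := hT₃p X hX
    have h2 : 2 ≤ (blocks (L ^ k) X).card :=
      two_le_card_blocks_of_not_isConn hMo hsodd hXp (hT₃ne X hX) (hT₃nc X hX)
    rcases mem_insert.1 hX₁ with rfl | h1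
    · rw [sdiff_empty] at hY
      by_cases hYX : Y = X
      · subst hYX; exact two_le_degree_self_of_not_isConn (L ^ k) (hT₃ne Y hX) (hT₃nc Y hX)
      · exact two_le_degree_of_ne_self hXp h2 hY hYX
    · rw [mem_singleton.1 h1, Finset.sdiff_self, polys_empty, mem_singleton] at hY
      subst hY
      rw [sdiff_empty]
      exact h2.trans (Nat.le_add_right _ _)
  have hE0 : 0 ≤ κ ^ (blocks (L ^ k) U).card *
      ((3 * (16 * Real.exp (3 / 8) * hamNorm (fieldWt h (L : ℝ) d k) ((L : ℝ) ^ k) (L ^ (d * k)) (Ht - Ht)) +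
          8 * Real.exp (1 / 4) * hamNorm (fieldWt h (L : ℝ) d k) ((L : ℝ) ^ k) (L ^ (d * k)) H + C) *
        (ω * A ^ 4)) := by
    have h1 := hnn (Ht - Ht); have h2 := hnn H
    have h3 : 0 ≤ 16 * Real.exp (3 / 8) *
        hamNorm (fieldWt h (L : ℝ) d k) ((L : ℝ) ^ k) (L ^ (d * k)) (Ht - Ht) := mul_nonneg (by positivity) h1
    have hκ0 : 0 ≤ κ := by have := Real.exp_pos (1 / 4 : ℝ); linarith
    have hω0 : 0 ≤ ω := le_trans (by have := hnn H; positivity) hbω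
    positivity
  have hc1 : (1 : ℝ) ≤ 2 * κ * max 1 A𝒫m := by
    have h3 : 0 ≤ 16 * Real.exp (3 / 8) *
        hamNorm (fieldWt h (L : ℝ) d k) ((L : ℝ) ^ k) (L ^ (d * k)) (Ht - Ht) := mul_nonneg (by positivity) (hnn _)
    have hκ1 : 1 ≤ κ := by have := Real.exp_pos (1 / 4 : ℝ); linarith
    have hm1 := le_max_left (1 : ℝ) A𝒫m
    have hκm : (1 : ℝ) * 1 ≤ κ * max 1 A𝒫m := mul_le_mul hκ1 hm1 zero_le_one (by linarith)
    linarith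
  -- the kernel slot is majorised by the letter slot, term by term (factor `ℓ`; the `H̃`-variation summands vanish)
  have hea : 0 ≤ Real.exp (1 / 4 : ℝ) := (Real.exp_pos _).le
  have h3x : 0 ≤ 16 * Real.exp (3 / 8) * hamNorm (fieldWt h (L : ℝ) d k) ((L : ℝ) ^ k) (L ^ (d * k)) (Ht - Ht) :=
    mul_nonneg (by positivity) (hnn _)
  have hτ0' : 0 ≤ τ := (hnn Ht).trans hHt
  have haF0 : ∀ Z, 0 ≤ P.aFactor k Z := fun Z => by rw [haF Z]; positivity
  have hGs0 : ∀ X₂ : Finset (Fin d → ZMod M), 0 ≤ ∑ Y ∈ polys (L ^ k) X₂, (∏ _B ∈ blocks (L ^ k) (X₂ \ Y),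
      8 * Real.exp (1 / 4) * hamNorm (fieldWt h (L : ℝ) d k) ((L : ℝ) ^ k) (L ^ (d * k)) H) *
      ∏ Z ∈ components Y, C * P.aFactor k Z := fun X₂ => by
    have := hnn H
    exact sum_nonneg fun Y _ => mul_nonneg (prod_nonneg fun _ _ => by positivity)
      (prod_nonneg fun Z _ => mul_nonneg hC (haF0 Z))
  have hLs0 : ∀ X₂ : Finset (Fin d → ZMod M), 0 ≤ ∑ Y ∈ polys (L ^ k) X₂,
      (((∏ _B ∈ blocks (L ^ k) (X₂ \ Y),
          (8 * Real.exp (1 / 4) * hamNorm (fieldWt h (L : ℝ) d k) ((L : ℝ) ^ k) (L ^ (d * k)) H +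
            8 * Real.exp (1 / 4) * hamNorm (fieldWt h (L : ℝ) d k) ((L : ℝ) ^ k) (L ^ (d * k)) H)) -
          ∏ _B ∈ blocks (L ^ k) (X₂ \ Y), 8 * Real.exp (1 / 4) * hamNorm (fieldWt h (L : ℝ) d k) ((L : ℝ) ^ k) (L ^ (d * k)) H) *
        ∏ Z ∈ components Y, C * P.aFactor k Z +
      (∏ _B ∈ blocks (L ^ k) (X₂ \ Y), 8 * Real.exp (1 / 4) * hamNorm (fieldWt h (L : ℝ) d k) ((L : ℝ) ^ k) (L ^ (d * k)) H) *
        ((∏ Z ∈ components Y, (C * P.aFactor k Z + C * P.aFactor k Z)) - ∏ Z ∈ components Y, C * P.aFactor k Z)) := by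
    intro X₂
    have := hnn H
    refine sum_nonneg fun Y _ => add_nonneg (mul_nonneg ?_ (prod_nonneg fun Z _ => mul_nonneg hC (haF0 Z)))
      (mul_nonneg (prod_nonneg fun _ _ => by positivity) ?_)
    · exact sub_nonneg.2 (prod_le_prod (fun _ _ => by positivity)
        (fun _ _ => le_add_of_nonneg_right (by positivity)))
    · exact sub_nonneg.2 (prod_le_prod (fun Z _ => mul_nonneg hC (haF0 Z))
        (fun Z _ => by linarith [mul_nonneg hC (haF0 Z)]))
  have hprodD : ∀ (S : Finset (Finset (Fin d → ZMod M))) (x y : ℝ), 0 ≤ x → 0 ≤ y →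
      0 ≤ (∏ _B ∈ S, (x + y)) - ∏ _B ∈ S, x := fun S x y hx hy =>
    sub_nonneg.2 (prod_le_prod (fun _ _ => hx) (fun _ _ => by linarith))
  have four_le : ∀ (S s4m s4L : ℝ), 0 ≤ S → s4m ≤ ℓ * s4L → 0 + 0 + 0 + s4m ≤ ℓ * (S + s4L) := by
    intro S s4m s4L hS h; nlinarith
  have hmaj : ∀ X X₁ : Finset (Fin d → ZMod M),
        (((∏ _B ∈ blocks (L ^ k) (U \ X), (Real.exp (1 / 4) +
              16 * Real.exp (3 / 8) * hamNorm (fieldWt h (L : ℝ) d k) ((L : ℝ) ^ k) (L ^ (d * k)) (Ht - Ht))) -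
            ∏ _B ∈ blocks (L ^ k) (U \ X), Real.exp (1 / 4)) *
            (∏ _B ∈ blocks (L ^ k) (X \ U), Real.exp (1 / 4)) *
            ((∏ _B ∈ blocks (L ^ k) X₁, 8 * Real.exp (1 / 4) * τ) *
              ((∑ Y ∈ polys (L ^ k) (X \ X₁), (∏ _B ∈ blocks (L ^ k) ((X \ X₁) \ Y),
                8 * Real.exp (1 / 4) * hamNorm (fieldWt h (L : ℝ) d k) ((L : ℝ) ^ k) (L ^ (d * k)) H) *
                ∏ Z ∈ components Y, C *
                  P.aFactor k Z) *
                A𝒫m ^ numBlocks (L ^ k) (X \ X₁))) +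
          (∏ _B ∈ blocks (L ^ k) (U \ X), Real.exp (1 / 4)) *
            ((∏ _B ∈ blocks (L ^ k) (X \ U), (Real.exp (1 / 4) +
              16 * Real.exp (3 / 8) * hamNorm (fieldWt h (L : ℝ) d k) ((L : ℝ) ^ k) (L ^ (d * k)) (Ht - Ht))) -
              ∏ _B ∈ blocks (L ^ k) (X \ U), Real.exp (1 / 4)) *
            ((∏ _B ∈ blocks (L ^ k) X₁, 8 * Real.exp (1 / 4) * τ) *
              ((∑ Y ∈ polys (L ^ k) (X \ X₁), (∏ _B ∈ blocks (L ^ k) ((X \ X₁) \ Y),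
                8 * Real.exp (1 / 4) * hamNorm (fieldWt h (L : ℝ) d k) ((L : ℝ) ^ k) (L ^ (d * k)) H) *
                ∏ Z ∈ components Y, C *
                  P.aFactor k Z) *
                A𝒫m ^ numBlocks (L ^ k) (X \ X₁))) +
          (∏ _B ∈ blocks (L ^ k) (U \ X), Real.exp (1 / 4)) * (∏ _B ∈ blocks (L ^ k) (X \ U), Real.exp (1 / 4)) *
            (((∏ _B ∈ blocks (L ^ k) X₁, (8 * Real.exp (1 / 4) * τ +
                16 * Real.exp (3 / 8) * hamNorm (fieldWt h (L : ℝ) d k) ((L : ℝ) ^ k) (L ^ (d * k)) (Ht - Ht))) -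
              ∏ _B ∈ blocks (L ^ k) X₁, 8 * Real.exp (1 / 4) * τ) *
              ((∑ Y ∈ polys (L ^ k) (X \ X₁), (∏ _B ∈ blocks (L ^ k) ((X \ X₁) \ Y),
                8 * Real.exp (1 / 4) * hamNorm (fieldWt h (L : ℝ) d k) ((L : ℝ) ^ k) (L ^ (d * k)) H) *
                ∏ Z ∈ components Y, C *
                  P.aFactor k Z) *
                A𝒫m ^ numBlocks (L ^ k) (X \ X₁))) +
          (∏ _B ∈ blocks (L ^ k) (U \ X), Real.exp (1 / 4)) * (∏ _B ∈ blocks (L ^ k) (X \ U), Real.exp (1 / 4)) *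
            ((∏ _B ∈ blocks (L ^ k) X₁, 8 * Real.exp (1 / 4) * τ) *
              (if X \ X₁ = ∅ then 0 else
                (∑ Y ∈ polys (L ^ k) (X \ X₁), (∏ _B ∈ blocks (L ^ k) ((X \ X₁) \ Y),
                  8 * Real.exp (1 / 4) * hamNorm (fieldWt h (L : ℝ) d k) ((L : ℝ) ^ k) (L ^ (d * k)) H) *
                  ∏ Z ∈ components Y, C *
                    P.aFactor k Z) *
                  ℓ * κp ^ numBlocks (L ^ k) (X \ X₁)))) ≤
      ℓ *
      (        (((∏ _B ∈ blocks (L ^ k) (U \ X), (Real.exp (1 / 4) + (16 * Real.exp (3 / 8) * hamNorm (fieldWt h (L : ℝ) d k) ((L : ℝ) ^ k) (L ^ (d * k)) (Ht - Ht)))) -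
            ∏ _B ∈ blocks (L ^ k) (U \ X), Real.exp (1 / 4)) *
            (∏ _B ∈ blocks (L ^ k) (X \ U), Real.exp (1 / 4)) *
            ((∏ _B ∈ blocks (L ^ k) X₁, 8 * Real.exp (1 / 4) * τ) *
              ((∑ Y ∈ polys (L ^ k) (X \ X₁), (∏ _B ∈ blocks (L ^ k) ((X \ X₁) \ Y),
                8 * Real.exp (1 / 4) * hamNorm (fieldWt h (L : ℝ) d k) ((L : ℝ) ^ k) (L ^ (d * k)) H) *
                ∏ Z ∈ components Y, C * P.aFactor k Z) *
                A𝒫m ^ numBlocks (L ^ k) (X \ X₁))) +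
          (∏ _B ∈ blocks (L ^ k) (U \ X), Real.exp (1 / 4)) *
            ((∏ _B ∈ blocks (L ^ k) (X \ U), (Real.exp (1 / 4) + (16 * Real.exp (3 / 8) * hamNorm (fieldWt h (L : ℝ) d k) ((L : ℝ) ^ k) (L ^ (d * k)) (Ht - Ht)))) -
              ∏ _B ∈ blocks (L ^ k) (X \ U), Real.exp (1 / 4)) *
            ((∏ _B ∈ blocks (L ^ k) X₁, 8 * Real.exp (1 / 4) * τ) *
              ((∑ Y ∈ polys (L ^ k) (X \ X₁), (∏ _B ∈ blocks (L ^ k) ((X \ X₁) \ Y),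
                8 * Real.exp (1 / 4) * hamNorm (fieldWt h (L : ℝ) d k) ((L : ℝ) ^ k) (L ^ (d * k)) H) *
                ∏ Z ∈ components Y, C * P.aFactor k Z) *
                A𝒫m ^ numBlocks (L ^ k) (X \ X₁))) +
          (∏ _B ∈ blocks (L ^ k) (U \ X), Real.exp (1 / 4)) * (∏ _B ∈ blocks (L ^ k) (X \ U), Real.exp (1 / 4)) *
            (((∏ _B ∈ blocks (L ^ k) X₁, (8 * Real.exp (1 / 4) * τ + (16 * Real.exp (3 / 8) * hamNorm (fieldWt h (L : ℝ) d k) ((L : ℝ) ^ k) (L ^ (d * k)) (Ht - Ht)))) -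
              ∏ _B ∈ blocks (L ^ k) X₁, 8 * Real.exp (1 / 4) * τ) *
              ((∑ Y ∈ polys (L ^ k) (X \ X₁), (∏ _B ∈ blocks (L ^ k) ((X \ X₁) \ Y),
                8 * Real.exp (1 / 4) * hamNorm (fieldWt h (L : ℝ) d k) ((L : ℝ) ^ k) (L ^ (d * k)) H) *
                ∏ Z ∈ components Y, C * P.aFactor k Z) *
                A𝒫m ^ numBlocks (L ^ k) (X \ X₁))) +
          (∏ _B ∈ blocks (L ^ k) (U \ X), Real.exp (1 / 4)) * (∏ _B ∈ blocks (L ^ k) (X \ U), Real.exp (1 / 4)) *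
            ((∏ _B ∈ blocks (L ^ k) X₁, 8 * Real.exp (1 / 4) * τ) *
              ((∑ Y ∈ polys (L ^ k) (X \ X₁),
                (((∏ _B ∈ blocks (L ^ k) ((X \ X₁) \ Y),
                    (8 * Real.exp (1 / 4) * hamNorm (fieldWt h (L : ℝ) d k) ((L : ℝ) ^ k) (L ^ (d * k)) H + 8 * Real.exp (1 / 4) * hamNorm (fieldWt h (L : ℝ) d k) ((L : ℝ) ^ k) (L ^ (d * k)) H)) -
                  ∏ _B ∈ blocks (L ^ k) ((X \ X₁) \ Y),
                    8 * Real.exp (1 / 4) * hamNorm (fieldWt h (L : ℝ) d k) ((L : ℝ) ^ k) (L ^ (d * k)) H) *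
                  ∏ Z ∈ components Y, C * P.aFactor k Z +
                (∏ _B ∈ blocks (L ^ k) ((X \ X₁) \ Y),
                    8 * Real.exp (1 / 4) * hamNorm (fieldWt h (L : ℝ) d k) ((L : ℝ) ^ k) (L ^ (d * k)) H) *
                  ((∏ Z ∈ components Y, (C * P.aFactor k Z + C * P.aFactor k Z)) -
                    ∏ Z ∈ components Y, C * P.aFactor k Z))) *
                A𝒫m ^ numBlocks (L ^ k) (X \ X₁))))) := by
    intro X X₁
    have hnnH := hnn H
    have hkey := kernelSlot_le_letterSlot (L ^ k) (b := 8 * Real.exp (1 / 4) *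
      hamNorm (fieldWt h (L : ℝ) d k) ((L : ℝ) ^ k) (L ^ (d * k)) H) (C := C) (by positivity) hC hℓ hκp hκpm haF0 (X \ X₁)
    have hp1 : 0 ≤ ∏ _B ∈ blocks (L ^ k) (U \ X), Real.exp (1 / 4) := prod_nonneg fun _ _ => hea
    have hp2 : 0 ≤ ∏ _B ∈ blocks (L ^ k) (X \ U), Real.exp (1 / 4) := prod_nonneg fun _ _ => hea
    have hp3 : 0 ≤ ∏ _B ∈ blocks (L ^ k) X₁, 8 * Real.exp (1 / 4) * τ := prod_nonneg fun _ _ => by positivity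
    rw [hprod0 (blocks (L ^ k) (U \ X)) (Real.exp (1 / 4)), hprod0 (blocks (L ^ k) (X \ U)) (Real.exp (1 / 4)),
      hprod0 (blocks (L ^ k) X₁) (8 * Real.exp (1 / 4) * τ)]
    simp only [zero_mul, mul_zero]
    refine four_le _ _ _ (by norm_num) ?_
    · calc (∏ _B ∈ blocks (L ^ k) (U \ X), Real.exp (1 / 4)) * (∏ _B ∈ blocks (L ^ k) (X \ U), Real.exp (1 / 4)) *
            ((∏ _B ∈ blocks (L ^ k) X₁, 8 * Real.exp (1 / 4) * τ) *
              (if X \ X₁ = ∅ then 0 else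
                (∑ Y ∈ polys (L ^ k) (X \ X₁), (∏ _B ∈ blocks (L ^ k) ((X \ X₁) \ Y),
                  8 * Real.exp (1 / 4) * hamNorm (fieldWt h (L : ℝ) d k) ((L : ℝ) ^ k) (L ^ (d * k)) H) *
                  ∏ Z ∈ components Y, C *
                    P.aFactor k Z) *
                  ℓ * κp ^ numBlocks (L ^ k) (X \ X₁)))
          ≤ (∏ _B ∈ blocks (L ^ k) (U \ X), Real.exp (1 / 4)) * (∏ _B ∈ blocks (L ^ k) (X \ U), Real.exp (1 / 4)) *
            ((∏ _B ∈ blocks (L ^ k) X₁, 8 * Real.exp (1 / 4) * τ) * (ℓ * _)) :=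
            mul_le_mul_of_nonneg_left (mul_le_mul_of_nonneg_left hkey hp3) (mul_nonneg hp1 hp2)
        _ = _ := by ring
  refine (sum_le_sum fun X _ => sum_le_sum fun X₁ _ => hmaj X X₁).trans ?_
  simp_rw [← mul_sum]
  rw [hEeq]
  refine mul_le_mul_of_nonneg_left ?_ hℓ
  refine le_trans (sum_le_sum fun X hX => sum_le_sum fun X₁ hX₁ => ?_)
    (sum_reblock_triples_le_pow (d := d) hLodd hL2 hL4 hM hkN hA1 hc1 hE0 hU' (𝓧' := T₃) hT₃T
      (𝓨 := fun X => ({∅, X} : Finset (Finset (Fin d → ZMod M)))) h𝓨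
      (𝓩 := fun X X₁ => polys (L ^ k) (X \ X₁)) (fun X _ X₁ _ => Subset.rfl)
      (F := fun X X₁ Y => (2 * κ * max 1 A𝒫m) ^ (blocks (L ^ k) X).card *
        (κ ^ (blocks (L ^ k) U).card *
          ((3 * (16 * Real.exp (3 / 8) * hamNorm (fieldWt h (L : ℝ) d k) ((L : ℝ) ^ k) (L ^ (d * k)) (Ht - Ht)) +
              8 * Real.exp (1 / 4) * hamNorm (fieldWt h (L : ℝ) d k) ((L : ℝ) ^ k) (L ^ (d * k)) H + C) *
            (ω * A ^ 4))) *
        (A ^ (2 * (blocks (L ^ k) (X \ Y)).card + (blocks (L ^ k) Y).card + (components Y).card))⁻¹)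
      (fun X _ X₁ _ Y _ => le_rfl))
  have hXp := hT₃p X hX
  have hX₁p : X₁ ∈ polys (L ^ k) X := h𝓨 X hX hX₁
  exact reblockTerm_lipschitzConsts_le (U := U) (X := X) (X₁ := X₁) hMo hsodd hA1 (Real.exp_pos _).le
    (by have := hnn (Ht - Ht); positivity) (by positivity) (by have := hnn H; positivity)
    (by have := hnn H; positivity) (by have := hnn H; positivity) hC hC hA𝒫m0 hθω' hbω hbbω hCω hωA hκ'
    haF hXp hX₁p (hstep X hX X₁ hX₁)


set_option maxHeartbeats 1600000 in
/-- **Kernel-only two-kernel piece of `Σ₄`, linear in `ℓ`** (pairs `∅ ≠ X₁ ⊊ X`): same data conventions as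
`tayNormLE_remainderTwoLarge_kernelOnly_sub_abkm` (one extracted Hamiltonian `H̃` on both sides); constant `ℓ`× the
one-kernel `Σ₄` constant in the letters `Δ := 0`, `Δ_H := 8e^{1/4}‖H‖_{k,0}`, `C_Δ := C`, `A_𝒫 := max(A_{𝒫,a}, κ_p)`.
[cite: AdamsBuchholzKoteckyMuller2019, Theorem 6.8 / Lemma 9.6 (proof, first order) / Lemma 12.6 (12.53)] -/
theorem tayNormLE_remainderFour_kernelOnly_sub_abkm {L N Mord R n p r₀ : ℕ} {θbar lam μ δ₁ δ₀ A𝒫 A𝒫a A𝒫b C₂a C₂b h A : ℝ}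
    {𝒞 : ℕ → (Fin d → ZMod M) → ℝ} (hd : 3 ≤ d) (hLodd : Odd L) (hL : 2 ^ (d + 3) + 16 * R ≤ L)
    (hR2 : 2 ≤ R) (hM : M = L ^ N) {k : ℕ} (hkN : k + 1 ≤ N)
    {𝒞a 𝒞b : (Fin d → ZMod M) → ℝ}
    (hSa : StepKernelBounds (abkmWeightData L N Mord R θbar (schedDelta δ₀ δ₁ N) 𝒞) L k A𝒫a C₂a 𝒞a)
    (hSb : StepKernelBounds (abkmWeightData L N Mord R θbar (schedDelta δ₀ δ₁ N) 𝒞) L k A𝒫b C₂b 𝒞b)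
    (hp : d / 2 + 1 ≤ p) (hMord : d / 2 + 1 ≤ Mord)
   
    (hB : AbkmWeightBounds L N Mord R n θbar lam μ δ₁ δ₀ A𝒫 𝒞
      (abkmWeightData L N Mord R θbar (schedDelta δ₀ δ₁ N) 𝒞))
    (hδ₀ : 0 < δ₀) (hδ₁ : 0 < δ₁) (hh : 0 < h) (hh0 : hZeroSq d R δ₀ δ₁ ≤ h ^ 2) (hA𝒫 : 0 ≤ A𝒫a) (hA1 : 1 ≤ A)
    {U : Finset (Fin d → ZMod M)} (hU : IsPolymer (L ^ (k + 1)) U)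
    {Ht H : RelevantHamiltonian ℂ d} {τ : ℝ}
    (hHt : hamNorm (fieldWt h (L : ℝ) d k) ((L : ℝ) ^ k) (L ^ (d * k)) Ht ≤ τ)
    (hτ : τ ≤ 1 / 16)
    (hH : hamNorm (fieldWt h (L : ℝ) d k) ((L : ℝ) ^ k) (L ^ (d * k)) H ≤ 1 / 16)
    {K : Finset (Fin d → ZMod M) → ((Fin d → ZMod M) → ℝ) → ℂ} {C : ℝ} (hC : 0 ≤ C)
    (hK : WeakNormLE (abkmNormParams L N Mord R p r₀ h θbar A (schedDelta δ₀ δ₁ N) 𝒞) k K C)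
    (hKfac : Factorises (L ^ k) K) (hK0 : ∀ φ, K ∅ φ = 1) (hKd : ∀ Y, ContDiff ℝ r₀ (K Y))
    (hKloc : ∀ Y, IsPolymer (L ^ k) Y → IsConn Y →
      IsGaugeLocal ((abkmNormParams L N Mord R p r₀ h θbar A (schedDelta δ₀ δ₁ N) 𝒞).gauge k Y) (K Y))
    {ℓ κp : ℝ} (hℓ : 0 ≤ ℓ) (hκp : 0 ≤ κp)
    (hdiff : ∀ X : Finset (Fin d → ZMod M), IsPolymer (L ^ k) X → X ⊆ thicken ((2 ^ d - 1) * L ^ k) U →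
      ∀ (F : ((Fin d → ZMod M) → ℝ) → ℂ) (b : ℝ), 0 ≤ b → ContDiff ℝ r₀ F →
        IsGaugeLocal ((abkmNormParams L N Mord R p r₀ h θbar A (schedDelta δ₀ δ₁ N) 𝒞).gauge k X) F →
        TayNormLE ((abkmNormParams L N Mord R p r₀ h θbar A (schedDelta δ₀ δ₁ N) 𝒞).gauge k X) r₀
          ((abkmWeightData L N Mord R θbar (schedDelta δ₀ δ₁ N) 𝒞).weight k X) F b →
          TayNormLE ((abkmNormParams L N Mord R p r₀ h θbar A (schedDelta δ₀ δ₁ N) 𝒞).gauge k X) r₀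
            ((abkmWeightData L N Mord R θbar (schedDelta δ₀ δ₁ N) 𝒞).midWeight k X)
            (fluct 𝒞a F - fluct 𝒞b F) (b * ℓ * κp ^ numBlocks (L ^ k) X))
    {ω κ : ℝ}
    (hθω : 8 * Real.exp (1 / 4) * τ ≤ ω)
    (hbbω : 8 * Real.exp (1 / 4) * hamNorm (fieldWt h (L : ℝ) d k) ((L : ℝ) ^ k) (L ^ (d * k)) H +
      8 * Real.exp (1 / 4) * hamNorm (fieldWt h (L : ℝ) d k) ((L : ℝ) ^ k) (L ^ (d * k)) H ≤ ω)
    (hCω : C + C ≤ ω) (hωA : ω * A ^ 2 ≤ 1)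
    (hκ : 1 + Real.exp (1 / 4) ≤ κ) :
    TayNormLE ((abkmNormParams L N Mord R p r₀ h θbar A (schedDelta δ₀ δ₁ N) 𝒞).gauge (k + 1) U) r₀
      ((abkmWeightData L N Mord R θbar (schedDelta δ₀ δ₁ N) 𝒞).weight (k + 1) U)
      (fun φ => ∑ X ∈ (polys (L ^ k) univ).filter (fun X => reblock (L ^ k) (L * L ^ k) X = U),
        ∑ X₁ ∈ ((polys (L ^ k) X).erase X).erase ∅,
        (bprod (L ^ k) (fun B => expNegH Ht B φ) (U \ X) * bprod (L ^ k) (fun B => expNegH (-Ht) B φ) (X \ U) *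
            (bprod (L ^ k) (fun B => 1 - expNegH Ht B φ) X₁ * fluct 𝒞a (polyP2 (L ^ k) H K (X \ X₁)) φ) -
          bprod (L ^ k) (fun B => expNegH Ht B φ) (U \ X) * bprod (L ^ k) (fun B => expNegH (-Ht) B φ) (X \ U) *
            (bprod (L ^ k) (fun B => 1 - expNegH Ht B φ) X₁ *
              fluct 𝒞b (polyP2 (L ^ k) H K (X \ X₁)) φ)))
      (ℓ *
      (κ ^ (blocks (L ^ k) U).card *
          ((8 * Real.exp (1 / 4) * hamNorm (fieldWt h (L : ℝ) d k) ((L : ℝ) ^ k) (L ^ (d * k)) H + C) *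
            (ω * A ^ 4)) *
        (((2 * (2 * κ * max 1 (max A𝒫a κp))) ^ ((2 ^ (d + 1) + 2) ^ d * L ^ d) * (4 : ℝ) ^ ((2 ^ (d + 1) + 2) ^ d * L ^ d)) ^
            (blocks (L * L ^ k) U).card *
          A ^ (-((1 + 1 / ((2 * (2 ^ d + 1) + 6 : ℝ) ^ d)) * (blocks (L * L ^ k) U).card) : ℝ)))) := by
  have hA : 0 < A := by linarith
  set A𝒫m : ℝ := max A𝒫a κp with hA𝒫m
  have hA𝒫m0 : 0 ≤ A𝒫m := le_max_of_le_left hA𝒫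
  have hκpm : κp ≤ A𝒫m := le_max_right _ _
  have hSa' : StepKernelBounds (abkmWeightData L N Mord R θbar (schedDelta δ₀ δ₁ N) 𝒞) L k A𝒫m C₂a 𝒞a :=
    hSa.mono_A𝒫 hA𝒫 (le_max_left _ _)
  set P := abkmNormParams L N Mord R p r₀ h θbar A (schedDelta δ₀ δ₁ N) 𝒞 with hP
  set T := (polys (L ^ k) univ).filter (fun X => reblock (L ^ k) (L * L ^ k) X = U) with hT
  -- the explicit per-term Lipschitz bound, summed over the fourth index family
  have htool := tayNormLE_subsum_reblockTerm_kernel_sub_abkm (n := n) (lam := lam) (μ := μ) hd hLodd hL hR2 hM hkN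
    hSa' hSb hp hMord hB hδ₀ hδ₁ hh hh0 hA𝒫m0 hA hU (𝓧' := T) Subset.rfl
    (𝓨 := fun X => ((polys (L ^ k) X).erase X).erase ∅)
    (fun X _ => (erase_subset _ _).trans (erase_subset _ _))
    hHt hHt hτ hH hC hK hKfac hK0 hKd hKloc hℓ hκp hdiff
  refine htool.mono ?_ (fun _ => (Real.exp_pos _).le)
  -- sizes and parities
  have h2dle : 2 ^ d ≤ 2 ^ (d + 3) := Nat.pow_le_pow_right (by norm_num) (by omega)
  have h1le : 1 ≤ 2 ^ d := Nat.one_le_two_pow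
  have hL2 : 2 ^ d + 1 ≤ L := by omega
  have hL4 : 4 ≤ L := by omega
  have hMo : Odd M := by rw [hM]; exact hLodd.pow
  have hsodd : Odd (L ^ k) := hLodd.pow
  have hU' : IsPolymer (L * L ^ k) U := by
    rw [show L * L ^ k = L ^ (k + 1) by rw [pow_succ']]; exact hU
  -- nonnegativity of the letters
  have hnn : ∀ H₀ : RelevantHamiltonian ℂ d,
      0 ≤ hamNorm (fieldWt h (L : ℝ) d k) ((L : ℝ) ^ k) (L ^ (d * k)) H₀ := fun H₀ =>
    hamNorm_nonneg (fieldWt_pos hh (by exact_mod_cast hLodd.pos) d k).le (by positivity) _ H₀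
  have hτ0 : 0 ≤ τ := (hnn Ht).trans hHt
  have haF : ∀ Z, P.aFactor k Z = (A ^ (blocks (L ^ k) Z).card)⁻¹ := fun Z => by
    rw [hP, NormParams.aFactor, abkmNormParams_A, abkmNormParams_L, card_blocks_eq_numBlocks]
  -- the `H̃`-difference letter vanishes (`H̃' = H̃`); the adapters' letters in that form
  have hΔ0 : hamNorm (fieldWt h (L : ℝ) d k) ((L : ℝ) ^ k) (L ^ (d * k)) (Ht - Ht) = 0 := by
    rw [sub_self, hamNorm_zero]
  have hθω' : 8 * Real.exp (1 / 4) * τ +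
      16 * Real.exp (3 / 8) * hamNorm (fieldWt h (L : ℝ) d k) ((L : ℝ) ^ k) (L ^ (d * k)) (Ht - Ht) ≤ ω := by
    rw [hΔ0, mul_zero, add_zero]; exact hθω
  have hbω : 8 * Real.exp (1 / 4) * hamNorm (fieldWt h (L : ℝ) d k) ((L : ℝ) ^ k) (L ^ (d * k)) H ≤ ω :=
    le_trans (le_add_of_nonneg_right (by have := hnn H; positivity)) hbbω
  have hκ' : 1 + Real.exp (1 / 4) +
      16 * Real.exp (3 / 8) * hamNorm (fieldWt h (L : ℝ) d k) ((L : ℝ) ^ k) (L ^ (d * k)) (Ht - Ht) ≤ κ := by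
    rw [hΔ0, mul_zero, add_zero]; exact hκ
  have hprod0 : ∀ (S : Finset (Finset (Fin d → ZMod M))) (x : ℝ),
      (∏ _B ∈ S, (x + 16 * Real.exp (3 / 8) * hamNorm (fieldWt h (L : ℝ) d k) ((L : ℝ) ^ k) (L ^ (d * k)) (Ht - Ht))) -
        ∏ _B ∈ S, x = 0 := fun S x => by
    rw [hΔ0, mul_zero, add_zero, sub_self]
  have hEeq : κ ^ (blocks (L ^ k) U).card *
      ((8 * Real.exp (1 / 4) * hamNorm (fieldWt h (L : ℝ) d k) ((L : ℝ) ^ k) (L ^ (d * k)) H + C) * (ω * A ^ 4)) =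
      κ ^ (blocks (L ^ k) U).card *
      ((3 * (16 * Real.exp (3 / 8) * hamNorm (fieldWt h (L : ℝ) d k) ((L : ℝ) ^ k) (L ^ (d * k)) (Ht - Ht)) +
          8 * Real.exp (1 / 4) * hamNorm (fieldWt h (L : ℝ) d k) ((L : ℝ) ^ k) (L ^ (d * k)) H + C) *
        (ω * A ^ 4)) := by
    rw [hΔ0]; ring
  -- Step 1: per `(X, X₁)`, the smallness adapter
  have hstep : ∀ X ∈ T, ∀ X₁ ∈ ((polys (L ^ k) X).erase X).erase ∅,
      ∀ Y ∈ polys (L ^ k) (X \ X₁), 2 ≤ (blocks (L ^ k) (X \ Y)).card + (components Y).card := by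
    intro X hX X₁ hX₁ Y hY
    have hXp : IsPolymer (L ^ k) X := (mem_polys.1 (mem_filter.1 hX).1).2
    obtain ⟨hX₁ne, hX₁'⟩ := mem_erase.1 hX₁
    obtain ⟨hX₁X, hX₁p⟩ := mem_erase.1 hX₁'
    exact two_le_degree_of_ssubset hXp hX₁p (nonempty_iff_ne_empty.2 hX₁ne) hX₁X hY
  have hE0 : 0 ≤ κ ^ (blocks (L ^ k) U).card *
      ((3 * (16 * Real.exp (3 / 8) * hamNorm (fieldWt h (L : ℝ) d k) ((L : ℝ) ^ k) (L ^ (d * k)) (Ht - Ht)) +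
          8 * Real.exp (1 / 4) * hamNorm (fieldWt h (L : ℝ) d k) ((L : ℝ) ^ k) (L ^ (d * k)) H + C) *
        (ω * A ^ 4)) := by
    have h1 := hnn (Ht - Ht); have h2 := hnn H
    have h3 : 0 ≤ 16 * Real.exp (3 / 8) *
        hamNorm (fieldWt h (L : ℝ) d k) ((L : ℝ) ^ k) (L ^ (d * k)) (Ht - Ht) := mul_nonneg (by positivity) h1
    have hκ0 : 0 ≤ κ := by have := Real.exp_pos (1 / 4 : ℝ); linarith
    have hω0 : 0 ≤ ω := le_trans (by have := hnn H; positivity) hbω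
    positivity
  have hc1 : (1 : ℝ) ≤ 2 * κ * max 1 A𝒫m := by
    have h3 : 0 ≤ 16 * Real.exp (3 / 8) *
        hamNorm (fieldWt h (L : ℝ) d k) ((L : ℝ) ^ k) (L ^ (d * k)) (Ht - Ht) := mul_nonneg (by positivity) (hnn _)
    have hκ1 : 1 ≤ κ := by have := Real.exp_pos (1 / 4 : ℝ); linarith
    have hm1 := le_max_left (1 : ℝ) A𝒫m
    have hκm : (1 : ℝ) * 1 ≤ κ * max 1 A𝒫m := mul_le_mul hκ1 hm1 zero_le_one (by linarith)
    linarith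
  -- the kernel slot is majorised by the letter slot, term by term (factor `ℓ`; the `H̃`-variation summands vanish)
  have hea : 0 ≤ Real.exp (1 / 4 : ℝ) := (Real.exp_pos _).le
  have h3x : 0 ≤ 16 * Real.exp (3 / 8) * hamNorm (fieldWt h (L : ℝ) d k) ((L : ℝ) ^ k) (L ^ (d * k)) (Ht - Ht) :=
    mul_nonneg (by positivity) (hnn _)
  have hτ0' : 0 ≤ τ := (hnn Ht).trans hHt
  have haF0 : ∀ Z, 0 ≤ P.aFactor k Z := fun Z => by rw [haF Z]; positivity
  have hGs0 : ∀ X₂ : Finset (Fin d → ZMod M), 0 ≤ ∑ Y ∈ polys (L ^ k) X₂, (∏ _B ∈ blocks (L ^ k) (X₂ \ Y),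
      8 * Real.exp (1 / 4) * hamNorm (fieldWt h (L : ℝ) d k) ((L : ℝ) ^ k) (L ^ (d * k)) H) *
      ∏ Z ∈ components Y, C * P.aFactor k Z := fun X₂ => by
    have := hnn H
    exact sum_nonneg fun Y _ => mul_nonneg (prod_nonneg fun _ _ => by positivity)
      (prod_nonneg fun Z _ => mul_nonneg hC (haF0 Z))
  have hLs0 : ∀ X₂ : Finset (Fin d → ZMod M), 0 ≤ ∑ Y ∈ polys (L ^ k) X₂,
      (((∏ _B ∈ blocks (L ^ k) (X₂ \ Y),
          (8 * Real.exp (1 / 4) * hamNorm (fieldWt h (L : ℝ) d k) ((L : ℝ) ^ k) (L ^ (d * k)) H +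
            8 * Real.exp (1 / 4) * hamNorm (fieldWt h (L : ℝ) d k) ((L : ℝ) ^ k) (L ^ (d * k)) H)) -
          ∏ _B ∈ blocks (L ^ k) (X₂ \ Y), 8 * Real.exp (1 / 4) * hamNorm (fieldWt h (L : ℝ) d k) ((L : ℝ) ^ k) (L ^ (d * k)) H) *
        ∏ Z ∈ components Y, C * P.aFactor k Z +
      (∏ _B ∈ blocks (L ^ k) (X₂ \ Y), 8 * Real.exp (1 / 4) * hamNorm (fieldWt h (L : ℝ) d k) ((L : ℝ) ^ k) (L ^ (d * k)) H) *
        ((∏ Z ∈ components Y, (C * P.aFactor k Z + C * P.aFactor k Z)) - ∏ Z ∈ components Y, C * P.aFactor k Z)) := by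
    intro X₂
    have := hnn H
    refine sum_nonneg fun Y _ => add_nonneg (mul_nonneg ?_ (prod_nonneg fun Z _ => mul_nonneg hC (haF0 Z)))
      (mul_nonneg (prod_nonneg fun _ _ => by positivity) ?_)
    · exact sub_nonneg.2 (prod_le_prod (fun _ _ => by positivity)
        (fun _ _ => le_add_of_nonneg_right (by positivity)))
    · exact sub_nonneg.2 (prod_le_prod (fun Z _ => mul_nonneg hC (haF0 Z))
        (fun Z _ => by linarith [mul_nonneg hC (haF0 Z)]))
  have hprodD : ∀ (S : Finset (Finset (Fin d → ZMod M))) (x y : ℝ), 0 ≤ x → 0 ≤ y →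
      0 ≤ (∏ _B ∈ S, (x + y)) - ∏ _B ∈ S, x := fun S x y hx hy =>
    sub_nonneg.2 (prod_le_prod (fun _ _ => hx) (fun _ _ => by linarith))
  have four_le : ∀ (S s4m s4L : ℝ), 0 ≤ S → s4m ≤ ℓ * s4L → 0 + 0 + 0 + s4m ≤ ℓ * (S + s4L) := by
    intro S s4m s4L hS h; nlinarith
  have hmaj : ∀ X X₁ : Finset (Fin d → ZMod M),
        (((∏ _B ∈ blocks (L ^ k) (U \ X), (Real.exp (1 / 4) +
              16 * Real.exp (3 / 8) * hamNorm (fieldWt h (L : ℝ) d k) ((L : ℝ) ^ k) (L ^ (d * k)) (Ht - Ht))) -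
            ∏ _B ∈ blocks (L ^ k) (U \ X), Real.exp (1 / 4)) *
            (∏ _B ∈ blocks (L ^ k) (X \ U), Real.exp (1 / 4)) *
            ((∏ _B ∈ blocks (L ^ k) X₁, 8 * Real.exp (1 / 4) * τ) *
              ((∑ Y ∈ polys (L ^ k) (X \ X₁), (∏ _B ∈ blocks (L ^ k) ((X \ X₁) \ Y),
                8 * Real.exp (1 / 4) * hamNorm (fieldWt h (L : ℝ) d k) ((L : ℝ) ^ k) (L ^ (d * k)) H) *
                ∏ Z ∈ components Y, C *
                  P.aFactor k Z) *
                A𝒫m ^ numBlocks (L ^ k) (X \ X₁))) +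
          (∏ _B ∈ blocks (L ^ k) (U \ X), Real.exp (1 / 4)) *
            ((∏ _B ∈ blocks (L ^ k) (X \ U), (Real.exp (1 / 4) +
              16 * Real.exp (3 / 8) * hamNorm (fieldWt h (L : ℝ) d k) ((L : ℝ) ^ k) (L ^ (d * k)) (Ht - Ht))) -
              ∏ _B ∈ blocks (L ^ k) (X \ U), Real.exp (1 / 4)) *
            ((∏ _B ∈ blocks (L ^ k) X₁, 8 * Real.exp (1 / 4) * τ) *
              ((∑ Y ∈ polys (L ^ k) (X \ X₁), (∏ _B ∈ blocks (L ^ k) ((X \ X₁) \ Y),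
                8 * Real.exp (1 / 4) * hamNorm (fieldWt h (L : ℝ) d k) ((L : ℝ) ^ k) (L ^ (d * k)) H) *
                ∏ Z ∈ components Y, C *
                  P.aFactor k Z) *
                A𝒫m ^ numBlocks (L ^ k) (X \ X₁))) +
          (∏ _B ∈ blocks (L ^ k) (U \ X), Real.exp (1 / 4)) * (∏ _B ∈ blocks (L ^ k) (X \ U), Real.exp (1 / 4)) *
            (((∏ _B ∈ blocks (L ^ k) X₁, (8 * Real.exp (1 / 4) * τ +
                16 * Real.exp (3 / 8) * hamNorm (fieldWt h (L : ℝ) d k) ((L : ℝ) ^ k) (L ^ (d * k)) (Ht - Ht))) -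
              ∏ _B ∈ blocks (L ^ k) X₁, 8 * Real.exp (1 / 4) * τ) *
              ((∑ Y ∈ polys (L ^ k) (X \ X₁), (∏ _B ∈ blocks (L ^ k) ((X \ X₁) \ Y),
                8 * Real.exp (1 / 4) * hamNorm (fieldWt h (L : ℝ) d k) ((L : ℝ) ^ k) (L ^ (d * k)) H) *
                ∏ Z ∈ components Y, C *
                  P.aFactor k Z) *
                A𝒫m ^ numBlocks (L ^ k) (X \ X₁))) +
          (∏ _B ∈ blocks (L ^ k) (U \ X), Real.exp (1 / 4)) * (∏ _B ∈ blocks (L ^ k) (X \ U), Real.exp (1 / 4)) *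
            ((∏ _B ∈ blocks (L ^ k) X₁, 8 * Real.exp (1 / 4) * τ) *
              (if X \ X₁ = ∅ then 0 else
                (∑ Y ∈ polys (L ^ k) (X \ X₁), (∏ _B ∈ blocks (L ^ k) ((X \ X₁) \ Y),
                  8 * Real.exp (1 / 4) * hamNorm (fieldWt h (L : ℝ) d k) ((L : ℝ) ^ k) (L ^ (d * k)) H) *
                  ∏ Z ∈ components Y, C *
                    P.aFactor k Z) *
                  ℓ * κp ^ numBlocks (L ^ k) (X \ X₁)))) ≤
      ℓ *
      (        (((∏ _B ∈ blocks (L ^ k) (U \ X), (Real.exp (1 / 4) + (16 * Real.exp (3 / 8) * hamNorm (fieldWt h (L : ℝ) d k) ((L : ℝ) ^ k) (L ^ (d * k)) (Ht - Ht)))) -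
            ∏ _B ∈ blocks (L ^ k) (U \ X), Real.exp (1 / 4)) *
            (∏ _B ∈ blocks (L ^ k) (X \ U), Real.exp (1 / 4)) *
            ((∏ _B ∈ blocks (L ^ k) X₁, 8 * Real.exp (1 / 4) * τ) *
              ((∑ Y ∈ polys (L ^ k) (X \ X₁), (∏ _B ∈ blocks (L ^ k) ((X \ X₁) \ Y),
                8 * Real.exp (1 / 4) * hamNorm (fieldWt h (L : ℝ) d k) ((L : ℝ) ^ k) (L ^ (d * k)) H) *
                ∏ Z ∈ components Y, C * P.aFactor k Z) *
                A𝒫m ^ numBlocks (L ^ k) (X \ X₁))) +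
          (∏ _B ∈ blocks (L ^ k) (U \ X), Real.exp (1 / 4)) *
            ((∏ _B ∈ blocks (L ^ k) (X \ U), (Real.exp (1 / 4) + (16 * Real.exp (3 / 8) * hamNorm (fieldWt h (L : ℝ) d k) ((L : ℝ) ^ k) (L ^ (d * k)) (Ht - Ht)))) -
              ∏ _B ∈ blocks (L ^ k) (X \ U), Real.exp (1 / 4)) *
            ((∏ _B ∈ blocks (L ^ k) X₁, 8 * Real.exp (1 / 4) * τ) *
              ((∑ Y ∈ polys (L ^ k) (X \ X₁), (∏ _B ∈ blocks (L ^ k) ((X \ X₁) \ Y),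
                8 * Real.exp (1 / 4) * hamNorm (fieldWt h (L : ℝ) d k) ((L : ℝ) ^ k) (L ^ (d * k)) H) *
                ∏ Z ∈ components Y, C * P.aFactor k Z) *
                A𝒫m ^ numBlocks (L ^ k) (X \ X₁))) +
          (∏ _B ∈ blocks (L ^ k) (U \ X), Real.exp (1 / 4)) * (∏ _B ∈ blocks (L ^ k) (X \ U), Real.exp (1 / 4)) *
            (((∏ _B ∈ blocks (L ^ k) X₁, (8 * Real.exp (1 / 4) * τ + (16 * Real.exp (3 / 8) * hamNorm (fieldWt h (L : ℝ) d k) ((L : ℝ) ^ k) (L ^ (d * k)) (Ht - Ht)))) -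
              ∏ _B ∈ blocks (L ^ k) X₁, 8 * Real.exp (1 / 4) * τ) *
              ((∑ Y ∈ polys (L ^ k) (X \ X₁), (∏ _B ∈ blocks (L ^ k) ((X \ X₁) \ Y),
                8 * Real.exp (1 / 4) * hamNorm (fieldWt h (L : ℝ) d k) ((L : ℝ) ^ k) (L ^ (d * k)) H) *
                ∏ Z ∈ components Y, C * P.aFactor k Z) *
                A𝒫m ^ numBlocks (L ^ k) (X \ X₁))) +
          (∏ _B ∈ blocks (L ^ k) (U \ X), Real.exp (1 / 4)) * (∏ _B ∈ blocks (L ^ k) (X \ U), Real.exp (1 / 4)) *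
            ((∏ _B ∈ blocks (L ^ k) X₁, 8 * Real.exp (1 / 4) * τ) *
              ((∑ Y ∈ polys (L ^ k) (X \ X₁),
                (((∏ _B ∈ blocks (L ^ k) ((X \ X₁) \ Y),
                    (8 * Real.exp (1 / 4) * hamNorm (fieldWt h (L : ℝ) d k) ((L : ℝ) ^ k) (L ^ (d * k)) H + 8 * Real.exp (1 / 4) * hamNorm (fieldWt h (L : ℝ) d k) ((L : ℝ) ^ k) (L ^ (d * k)) H)) -
                  ∏ _B ∈ blocks (L ^ k) ((X \ X₁) \ Y),
                    8 * Real.exp (1 / 4) * hamNorm (fieldWt h (L : ℝ) d k) ((L : ℝ) ^ k) (L ^ (d * k)) H) *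
                  ∏ Z ∈ components Y, C * P.aFactor k Z +
                (∏ _B ∈ blocks (L ^ k) ((X \ X₁) \ Y),
                    8 * Real.exp (1 / 4) * hamNorm (fieldWt h (L : ℝ) d k) ((L : ℝ) ^ k) (L ^ (d * k)) H) *
                  ((∏ Z ∈ components Y, (C * P.aFactor k Z + C * P.aFactor k Z)) -
                    ∏ Z ∈ components Y, C * P.aFactor k Z))) *
                A𝒫m ^ numBlocks (L ^ k) (X \ X₁))))) := by
    intro X X₁
    have hnnH := hnn H
    have hkey := kernelSlot_le_letterSlot (L ^ k) (b := 8 * Real.exp (1 / 4) *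
      hamNorm (fieldWt h (L : ℝ) d k) ((L : ℝ) ^ k) (L ^ (d * k)) H) (C := C) (by positivity) hC hℓ hκp hκpm haF0 (X \ X₁)
    have hp1 : 0 ≤ ∏ _B ∈ blocks (L ^ k) (U \ X), Real.exp (1 / 4) := prod_nonneg fun _ _ => hea
    have hp2 : 0 ≤ ∏ _B ∈ blocks (L ^ k) (X \ U), Real.exp (1 / 4) := prod_nonneg fun _ _ => hea
    have hp3 : 0 ≤ ∏ _B ∈ blocks (L ^ k) X₁, 8 * Real.exp (1 / 4) * τ := prod_nonneg fun _ _ => by positivity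
    rw [hprod0 (blocks (L ^ k) (U \ X)) (Real.exp (1 / 4)), hprod0 (blocks (L ^ k) (X \ U)) (Real.exp (1 / 4)),
      hprod0 (blocks (L ^ k) X₁) (8 * Real.exp (1 / 4) * τ)]
    simp only [zero_mul, mul_zero]
    refine four_le _ _ _ (by norm_num) ?_
    · calc (∏ _B ∈ blocks (L ^ k) (U \ X), Real.exp (1 / 4)) * (∏ _B ∈ blocks (L ^ k) (X \ U), Real.exp (1 / 4)) *
            ((∏ _B ∈ blocks (L ^ k) X₁, 8 * Real.exp (1 / 4) * τ) *
              (if X \ X₁ = ∅ then 0 else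
                (∑ Y ∈ polys (L ^ k) (X \ X₁), (∏ _B ∈ blocks (L ^ k) ((X \ X₁) \ Y),
                  8 * Real.exp (1 / 4) * hamNorm (fieldWt h (L : ℝ) d k) ((L : ℝ) ^ k) (L ^ (d * k)) H) *
                  ∏ Z ∈ components Y, C *
                    P.aFactor k Z) *
                  ℓ * κp ^ numBlocks (L ^ k) (X \ X₁)))
          ≤ (∏ _B ∈ blocks (L ^ k) (U \ X), Real.exp (1 / 4)) * (∏ _B ∈ blocks (L ^ k) (X \ U), Real.exp (1 / 4)) *
            ((∏ _B ∈ blocks (L ^ k) X₁, 8 * Real.exp (1 / 4) * τ) * (ℓ * _)) :=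
            mul_le_mul_of_nonneg_left (mul_le_mul_of_nonneg_left hkey hp3) (mul_nonneg hp1 hp2)
        _ = _ := by ring
  refine (sum_le_sum fun X _ => sum_le_sum fun X₁ _ => hmaj X X₁).trans ?_
  simp_rw [← mul_sum]
  rw [hEeq]
  refine mul_le_mul_of_nonneg_left ?_ hℓ
  refine le_trans (sum_le_sum fun X hX => sum_le_sum fun X₁ hX₁ => ?_)
    (sum_reblock_triples_le_pow (d := d) hLodd hL2 hL4 hM hkN hA1 hc1 hE0 hU' (𝓧' := T) Subset.rfl
      (𝓨 := fun X => ((polys (L ^ k) X).erase X).erase ∅)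
      (fun X _ => (erase_subset _ _).trans (erase_subset _ _))
      (𝓩 := fun X X₁ => polys (L ^ k) (X \ X₁)) (fun X _ X₁ _ => Subset.rfl)
      (F := fun X X₁ Y => (2 * κ * max 1 A𝒫m) ^ (blocks (L ^ k) X).card *
        (κ ^ (blocks (L ^ k) U).card *
          ((3 * (16 * Real.exp (3 / 8) * hamNorm (fieldWt h (L : ℝ) d k) ((L : ℝ) ^ k) (L ^ (d * k)) (Ht - Ht)) +
              8 * Real.exp (1 / 4) * hamNorm (fieldWt h (L : ℝ) d k) ((L : ℝ) ^ k) (L ^ (d * k)) H + C) *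
            (ω * A ^ 4))) *
        (A ^ (2 * (blocks (L ^ k) (X \ Y)).card + (blocks (L ^ k) Y).card + (components Y).card))⁻¹)
      (fun X _ X₁ _ Y _ => le_rfl))
  have hXp : IsPolymer (L ^ k) X := (mem_polys.1 (mem_filter.1 hX).1).2
  have hX₁p : X₁ ∈ polys (L ^ k) X := (mem_erase.1 (mem_erase.1 hX₁).2).2
  exact reblockTerm_lipschitzConsts_le (U := U) (X := X) (X₁ := X₁) hMo hsodd hA1 (Real.exp_pos _).le
    (by have := hnn (Ht - Ht); positivity) (by positivity) (by have := hnn H; positivity)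
    (by have := hnn H; positivity) (by have := hnn H; positivity) hC hC hA𝒫m0 hθω' hbω hbbω hCω hωA hκ'
    haF hXp hX₁p (hstep X hX X₁ hX₁)


end Literature.MathematicalPhysics.StatisticalMechanics.GradientRG

end
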